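import Summits.BirchSwinnertonDyer.BirchSwinnertonDyer.Theorems.BiquadraticEisensteinDescentHeegnerTwistCouplingInSupplyThreeSquaresPinCornerDual
import Summits.BirchSwinnertonDyer.BirchSwinnertonDyer.Theorems.BiquadraticEisensteinDescentHeegnerTwistCouplingInSupplyIndefinitePin
import Summits.BirchSwinnertonDyer.BirchSwinnertonDyer.Theorems.BiquadraticEisensteinDescentHeegnerTwistCouplingInSupplyPartnerTables
import Literature.NumberTheory.QuadraticFields.ImaginaryQuadraticClassNumberValues
import HarnessLib

set_option linter.dupNamespace false -- `Summit.BirchSwinnertonDyer.BirchSwinnertonDyer.Theorems.…` (summit = sub)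
set_option autoImplicit false

/-!
# Crux `HeegnerTwistCouplingInSupply` (stmt-BirchSwinnertonDyer-21381) — the witness field `K′ = ℚ(√−5q)` for the
# indefinite pins: size lever `π⁻¹√x log x < p` for `x < c·p`, Heegner data, and `h(K′) < p` for EVERY prime
# `p ≡ 3 (mod 4)` (`p ≡ ±2 (mod 5)`, type `(3,+)`) resp. `p ≡ 3 (mod 8)` (`p ≡ ±1 (mod 5)`, type `(3,−)`)

Route `BiquadraticEisensteinDescent` (cell `pub/bsd-wall`, row-12 line lead `bsd-line-ibd-p1` g11). The FIELD half on top of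
this lead's `…IndefinitePin` (p648070: auxiliary primes `q ≡ 3 (mod 8)` of type `(3,+)`, `q ≤ 10p` for `p ≥ 800`, and of
type `(3,−)`, `q ≤ 4p` for `p ≥ 200`, from INDEFINITE ternary forms) and `…PartnerTables` (p648499: kernel partners
below `800` / `200` with `h(−5q) < p`). The partner prime `5` sits on the other side of the Monsky cell (`5` has type
`(5,−)` iff `p ≡ ±2 (mod 5)`, type `(5,+)` iff `p ≡ ±1 (mod 5)`), the Heegner field is `K′ = ℚ(√−5q)` (`−5q ≡ 1 (mod 8)`:
`2` splits; `(−5q/p) = +1`: `p` splits), `|d_{K′}| = 5q ≤ 50p`, and `h(K′) < p` either by the class number formula bound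
`h ≤ π⁻¹√|d| log|d|` (tree, PROVED: `classNumber_lt_of_sqrt_mul_log_lt`) through the elementary inequality of §1
(`π⁻¹√x log x < p` whenever `x < c·p` and `8⁸c⁵ ≤ (2.718·3.1415)⁸P³`, `P ≤ p`; instances `c = 50, P = 800` and
`c = 20, P = 200`), or, below those thresholds, by the kernel tables read on the field side (Cox Thm. 7.7(ii),
`ClassNumberValues.classNumber_eq_of_discr_eq`). Main statements: `exists_threePlus_classNumber_lt` (every prime
`p ≡ 3 (mod 4)`, `p ≡ ±2 (mod 5)`, `p ≥ 7`: a prime `q ≡ 3 (mod 8)`, `(q/p) = +1`, and `h(K) < p` for every imaginary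
quadratic `K` of discriminant `−5q`) and `exists_threeMinus_classNumber_lt` (every prime `p ≡ 3 (mod 8)`, `p ≡ ±1 (mod 5)`).
THEOREMS ONLY (unconditional); nothing about `L`-values, the crux or any case of BSD is asserted. The corner theorems
(with the `L`-half) are in `…IndefinitePinCorner.lean`. Supports stmt-BirchSwinnertonDyer-21381.
-/

namespace Summit.BirchSwinnertonDyer.BirchSwinnertonDyer.Theorems.BiquadraticEisensteinDescentHeegnerTwistCouplingInSupplyIndefinitePinWitness

open Literature.NumberTheory.EllipticCurves Literature.NumberTheory.EllipticCurves.HeathBrown1994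
  Literature.NumberTheory.EllipticCurves.HeathBrown1994.Families
  Literature.NumberTheory.QuadraticFields Literature.NumberTheory.QuadraticFields.Quadratic
  Summit.BirchSwinnertonDyer.BirchSwinnertonDyer.Theorems.BiquadraticEisensteinDescentHeegnerTwistCouplingInSupplyThreeSquaresPinDual
  Summit.BirchSwinnertonDyer.BirchSwinnertonDyer.Theorems.BiquadraticEisensteinDescentHeegnerTwistCouplingInSupplyMonskyCells
  Summit.BirchSwinnertonDyer.BirchSwinnertonDyer.Theorems.BiquadraticEisensteinDescentHeegnerTwistCouplingInSupplyThreeSquaresPinRankZero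
  Summit.BirchSwinnertonDyer.BirchSwinnertonDyer.Theorems.BiquadraticEisensteinDescentHeegnerTwistCouplingInSupplySizeIndivisibleSharp
  Summit.BirchSwinnertonDyer.BirchSwinnertonDyer.Theorems.BiquadraticEisensteinDescentHeegnerTwistCouplingInSupplyThreeSquaresPinCorner
  Summit.BirchSwinnertonDyer.BirchSwinnertonDyer.Theorems.BiquadraticEisensteinDescentHeegnerTwistCouplingInSupplyThreeSquaresPinCornerDual
  Summit.BirchSwinnertonDyer.BirchSwinnertonDyer.Theorems.BiquadraticEisensteinDescentHeegnerTwistCouplingInSupplyIndefinitePin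
  Summit.BirchSwinnertonDyer.BirchSwinnertonDyer.Theorems.BiquadraticEisensteinDescentHeegnerTwistCouplingInSupplyPartnerTables

/-! ## §1 The size lever for `|d| < c·p`: `π⁻¹ √x log x < p` -/

/-- **Parametric size lever.** For real `0 < x < c·p` (any real `c`) with `8⁸·c⁵ ≤ (2.718·3.1415)⁸·P³` and `P ≤ p`:
`π⁻¹·√x·log x < p`. Proof: with `y = x^{1/8}`, `log x = 8 log y ≤ 8y/e`, so `√x log x ≤ 8y⁵/e`, and
`(8y⁵)⁸ = 8⁸x⁵ < 8⁸c⁵p⁵ ≤ (eπ)⁸p⁸`. [folklore] -/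
theorem inv_pi_mul_sqrt_mul_log_lt_of_lt_mul {x c P : ℝ} {p : ℕ} (hx : 0 < x) (hxc : x < c * p)
    (hkey : (8 : ℝ) ^ 8 * c ^ 5 ≤ (2.718 * 3.1415) ^ 8 * P ^ 3) (hP0 : 0 < P) (hP : P ≤ p) :
    Real.pi⁻¹ * Real.sqrt x * Real.log x < p := by
  have hp0 : (0 : ℝ) < p := hP0.trans_le hP
  set y : ℝ := Real.sqrt (Real.sqrt (Real.sqrt x)) with hy
  have hs1 : 0 < Real.sqrt x := Real.sqrt_pos.mpr hx
  have hs2 : 0 < Real.sqrt (Real.sqrt x) := Real.sqrt_pos.mpr hs1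
  have hy0 : 0 < y := Real.sqrt_pos.mpr hs2
  have hy2 : y ^ 2 = Real.sqrt (Real.sqrt x) := Real.sq_sqrt hs2.le
  have hy4 : y ^ 4 = Real.sqrt x := by
    have : y ^ 4 = (y ^ 2) ^ 2 := by ring
    rw [this, hy2, Real.sq_sqrt hs1.le]
  have hy8 : y ^ 8 = x := by
    have : y ^ 8 = (y ^ 4) ^ 2 := by ring
    rw [this, hy4, Real.sq_sqrt hx.le]
  have hlogx : Real.log x = 8 * Real.log y := by
    rw [← hy8, Real.log_pow]
    norm_num
  have hlogy : Real.log y ≤ y / Real.exp 1 := Literature.NumberTheory.Sieve.Lichtman2020.log_le_div_exp_one hy0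
  have hpi : (3.1415 : ℝ) < Real.pi := Real.pi_gt_d4
  have he : (2.718 : ℝ) < Real.exp 1 := lt_trans (by norm_num) Real.exp_one_gt_d9
  have hpi0 : 0 < Real.pi := Real.pi_pos
  have he0 : 0 < Real.exp 1 := Real.exp_pos 1
  -- `√x log x ≤ 8 y⁵ / e`
  have hmain : Real.sqrt x * Real.log x ≤ 8 * y ^ 5 / Real.exp 1 := by
    rw [hlogx, ← hy4]
    have : y ^ 4 * (8 * Real.log y) ≤ y ^ 4 * (8 * (y / Real.exp 1)) :=
      mul_le_mul_of_nonneg_left (by linarith) (by positivity)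
    calc y ^ 4 * (8 * Real.log y) ≤ y ^ 4 * (8 * (y / Real.exp 1)) := this
      _ = 8 * y ^ 5 / Real.exp 1 := by ring
  -- `8 y⁵ < e π p` by comparing eighth powers
  have h8 : 8 * y ^ 5 < Real.exp 1 * Real.pi * p := by
    have hA : 0 ≤ 8 * y ^ 5 := by positivity
    have hB : 0 ≤ Real.exp 1 * Real.pi * p := by positivity
    refine lt_of_pow_lt_pow_left₀ 8 hB ?_
    have hx5 : x ^ 5 < (c * p) ^ 5 := pow_lt_pow_left₀ hxc hx.le (by norm_num)
    have hP3 : P ^ 3 ≤ (p : ℝ) ^ 3 := pow_le_pow_left₀ hP0.le hP 3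
    have hepi : (2.718 * 3.1415 : ℝ) ^ 8 ≤ (Real.exp 1 * Real.pi) ^ 8 :=
      pow_le_pow_left₀ (by norm_num) (by nlinarith) 8
    calc (8 * y ^ 5) ^ 8 = 8 ^ 8 * (y ^ 8) ^ 5 := by ring
      _ = 8 ^ 8 * x ^ 5 := by rw [hy8]
      _ < 8 ^ 8 * (c * p) ^ 5 := by gcongr
      _ = (8 ^ 8 * c ^ 5) * (p : ℝ) ^ 5 := by ring
      _ ≤ ((2.718 * 3.1415) ^ 8 * P ^ 3) * (p : ℝ) ^ 5 := by gcongr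
      _ ≤ ((Real.exp 1 * Real.pi) ^ 8 * (p : ℝ) ^ 3) * (p : ℝ) ^ 5 := by gcongr
      _ = (Real.exp 1 * Real.pi * p) ^ 8 := by ring
  calc Real.pi⁻¹ * Real.sqrt x * Real.log x = Real.pi⁻¹ * (Real.sqrt x * Real.log x) := by ring
    _ ≤ Real.pi⁻¹ * (8 * y ^ 5 / Real.exp 1) := mul_le_mul_of_nonneg_left hmain (inv_pos.mpr hpi0).le
    _ < Real.pi⁻¹ * (Real.exp 1 * Real.pi * p / Real.exp 1) := by
        apply mul_lt_mul_of_pos_left _ (inv_pos.mpr hpi0)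
        exact div_lt_div_of_pos_right h8 he0
    _ = p := by field_simp

/-- Instance `c = 50`, `p ≥ 800`: `x < 50p ⇒ π⁻¹√x log x < p` (`8⁸·50⁵ = 5.24·10¹⁵ ≤ 8.5386⁸·800³ = 1.44·10¹⁶`).
[folklore] -/
theorem inv_pi_mul_sqrt_mul_log_lt_fifty {x : ℝ} {p : ℕ} (hx : 0 < x) (hxc : x < 50 * p) (h800 : 800 ≤ p) :
    Real.pi⁻¹ * Real.sqrt x * Real.log x < p :=
  inv_pi_mul_sqrt_mul_log_lt_of_lt_mul (c := 50) (P := 800) hx hxc (by norm_num) (by norm_num)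
    (by exact_mod_cast h800)

/-- Instance `c = 20`, `p ≥ 200`: `x < 20p ⇒ π⁻¹√x log x < p`. [folklore] -/
theorem inv_pi_mul_sqrt_mul_log_lt_twenty {x : ℝ} {p : ℕ} (hx : 0 < x) (hxc : x < 20 * p) (h200 : 200 ≤ p) :
    Real.pi⁻¹ * Real.sqrt x * Real.log x < p :=
  inv_pi_mul_sqrt_mul_log_lt_of_lt_mul (c := 20) (P := 200) hx hxc (by norm_num) (by norm_num)
    (by exact_mod_cast h200)

/-! ## §2 The witness field `K′ = ℚ(√−5q)` -/

/-- **The witness field for a partner `5` and an auxiliary prime `q ≡ 3 (mod 8)`.** For a prime `p`, a prime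
`q ≡ 3 (mod 8)` with `(−5q/p) = +1`, and any bound `h(·) < p` valid for every imaginary quadratic field of discriminant
`−5q`: `K′ = ℚ(√−5q)` is imaginary quadratic, `d_{K′} = −5q`, Heegner for every level `N` with prime divisors in
`{2, p}`, and `h(K′) < p`. [cite: Marcus2018, Ch. 2 Thm. 1; Ch. 3 Thm. 25] -/
theorem exists_witnessField_five_of {p q : ℕ} (hq : q.Prime) (hq8 : q % 8 = 3)
    (hJ5 : jacobiSym (-(5 * (q : ℤ))) p = 1)
    (hh : ∀ (K : Type) [Field K] [NumberField K], IsImaginaryQuadratic K →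
      NumberField.discr K = -((5 * q : ℕ) : ℤ) → NumberField.classNumber K < p)
    {N : ℕ} (hN : ∀ r : ℕ, r.Prime → r ∣ N → r = 2 ∨ r = p) :
    ∃ (K : Type) (_ : Field K) (_ : NumberField K),
      IsImaginaryQuadratic K ∧ NumberField.discr K = -((5 * q : ℕ) : ℤ) ∧
      SatisfiesHeegnerHypothesis N K ∧ NumberField.classNumber K < p := by
  haveI : Fact ((-((5 * q : ℕ) : ℤ)) < 0) := ⟨by have := hq.two_le; omega⟩
  have hq5 : q ≠ 5 := by
    rintro rfl
    omega
  have hsf : Squarefree (-((5 * q : ℕ) : ℤ)).natAbs := by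
    rw [Int.natAbs_neg, Int.natAbs_natCast]
    exact squarefree_five_mul hq hq5
  have hD8 : (-((5 * q : ℕ) : ℤ)) % 8 = 1 := by omega
  obtain ⟨hK, hdK⟩ := isImaginaryQuadratic_and_discr_sqrtField_of_squarefree_natAbs (-((5 * q : ℕ) : ℤ))
    (by omega) hsf
  have hJ5' : jacobiSym (-((5 * q : ℕ) : ℤ)) p = 1 := by
    have : (-((5 * q : ℕ) : ℤ)) = -(5 * (q : ℤ)) := by push_cast; ring
    rw [this]
    exact hJ5
  refine ⟨sqrtField (-((5 * q : ℕ) : ℤ)), inferInstance, inferInstance, hK, hdK, ?_, hh _ hK hdK⟩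
  refine satisfiesHeegnerHypothesis_sqrtField_of_squarefree_natAbs _ hD8 hsf fun r hr hrN => ?_
  rcases hN r hr hrN with rfl | rfl
  · exact Or.inl rfl
  · exact Or.inr hJ5'

/-- `h(K′) < p` from a kernel value of the form class number: every imaginary quadratic `K` with `d_K = −5q` has
`h_K = h(−5q)`. [cite: Cox2013, §2.A Thm. 2.13; §7.B Thm. 7.7(ii)] -/
theorem classNumber_lt_of_binQF {p q : ℕ} (hq : q.Prime) (hh : BinQF.classNumber (-((5 * q : ℕ) : ℤ)) < p) :
    ∀ (K : Type) [Field K] [NumberField K], IsImaginaryQuadratic K →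
      NumberField.discr K = -((5 * q : ℕ) : ℤ) → NumberField.classNumber K < p := by
  intro K _ _ hK hdK
  rw [ClassNumberValues.classNumber_eq_of_discr_eq hK.1 hdK (by have := hq.two_le; omega) rfl]
  exact hh

/-- `h(K′) < p` from the class number formula bound when `5q < c·p` (size lever §1). [cite: Oesterle1988Gauss, II §3 Proposition p. 57 (27)] -/
theorem classNumber_lt_of_size {p q : ℕ} (hq : q.Prime)
    (hlt : Real.pi⁻¹ * Real.sqrt ((5 * q : ℕ) : ℝ) * Real.log ((5 * q : ℕ) : ℝ) < p) :
    ∀ (K : Type) [Field K] [NumberField K], IsImaginaryQuadratic K →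
      NumberField.discr K = -((5 * q : ℕ) : ℤ) → NumberField.classNumber K < p := by
  intro K _ _ hK hdK
  have h4 : 4 < (NumberField.discr K).natAbs := by
    rw [hdK, Int.natAbs_neg, Int.natAbs_natCast]
    have := hq.two_le
    omega
  refine classNumber_lt_of_sqrt_mul_log_lt hK h4 ?_
  rw [hdK, Int.natAbs_neg, Int.natAbs_natCast]
  exact hlt

/-! ## §3 Symbols at the partner `5` -/

/-- `(5/p) = −1` for `p` odd with `p ≡ ±2 (mod 5)`: `(5/p) = (p/5) = (2/5), (3/5) = −1`. [folklore] -/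
theorem jacobiSym_five_eq_neg_one {p : ℕ} (hp2 : p % 2 = 1) (hp5 : p % 5 = 2 ∨ p % 5 = 3) :
    jacobiSym 5 p = -1 := by
  have hpodd : Odd p := Nat.odd_iff.mpr hp2
  have hrec := jacobiSym.quadratic_reciprocity_one_mod_four (a := 5) (b := p) (by norm_num) hpodd
  have hcast : ((5 : ℕ) : ℤ) = 5 := by norm_num
  rw [hcast] at hrec
  rw [hrec, jacobiSym.mod_left (p : ℤ) 5]
  rcases hp5 with h | h
  · have h25 : (p : ℤ) % ((5 : ℕ) : ℤ) = 2 := by push_cast; omega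
    rw [h25]
    exact jacobiSym_two_eq_neg_one (Or.inr (by norm_num))
  · have h35 : (p : ℤ) % ((5 : ℕ) : ℤ) = 3 := by push_cast; omega
    rw [h35]
    have : jacobiSym 3 5 = jacobiSym ((3 : ℕ) : ℤ) 5 := by norm_num
    rw [this, jacobiSym.quadratic_reciprocity_one_mod_four' (a := 3) (b := 5) (by decide) (by norm_num)]
    have h53 : ((5 : ℕ) : ℤ) % ((3 : ℕ) : ℤ) = 2 := by norm_num
    rw [jacobiSym.mod_left, h53]
    exact jacobiSym_two_eq_neg_one (Or.inl (by norm_num))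

/-- `(−5q/p) = +1` in cell A: `p ≡ 3 (mod 4)`, `p ≡ ±2 (mod 5)` (`(−1/p) = (5/p) = −1`) and `(q/p) = +1`. [folklore] -/
theorem jacobiSym_neg_five_mul_cellA {p q : ℕ} (hp4 : p % 4 = 3) (hp5 : p % 5 = 2 ∨ p % 5 = 3)
    (hJ : jacobiSym (q : ℤ) p = 1) : jacobiSym (-(5 * (q : ℤ))) p = 1 := by
  have hpodd : Odd p := Nat.odd_iff.mpr (by omega)
  have hm1 : jacobiSym (-1) p = -1 := DeuringLadic.jacobiSym_neg_one_of_mod_four hp4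
  have h5 : jacobiSym 5 p = -1 := jacobiSym_five_eq_neg_one (by omega) hp5
  have : (-(5 * (q : ℤ))) = (-1) * 5 * (q : ℤ) := by ring
  rw [this, jacobiSym.mul_left, jacobiSym.mul_left, hm1, h5, hJ]
  norm_num

/-- `(−5q/p) = +1` in cell B: `p ≡ 3 (mod 4)`, `p ≡ ±1 (mod 5)` (`(−5/p) = −1`, p643125) and `(q/p) = −1`. [folklore] -/
theorem jacobiSym_neg_five_mul_cellB {p q : ℕ} (hp4 : p % 4 = 3) (hp5 : p % 5 = 1 ∨ p % 5 = 4)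
    (hJ : jacobiSym (q : ℤ) p = -1) : jacobiSym (-(5 * (q : ℤ))) p = 1 := by
  have : (-(5 * (q : ℤ))) = (-5) * (q : ℤ) := by ring
  rw [this, jacobiSym.mul_left, jacobiSym_neg_five hp4 hp5, hJ]
  norm_num

/-- `q ≠ p` when `(q/p) ≠ 0` (`(p/p) = 0`). [folklore] -/
theorem ne_of_jacobiSym_ne_zero {p q : ℕ} (hp : p.Prime) (hJ : jacobiSym (q : ℤ) p ≠ 0) : q ≠ p := by
  rintro rfl
  apply hJ
  rw [jacobiSym.eq_zero_iff]
  refine ⟨hp.ne_zero, ?_⟩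
  rw [Int.gcd_natCast_natCast, Nat.gcd_self]
  exact hp.one_lt.ne'

/-! ## §4 The auxiliary prime with its class-number certificate (table below the threshold, indefinite pin above) -/

/-- **Type `(3,+)` with `h(ℚ(√−5q)) < p`, every prime `p ≡ 3 (mod 4)`, `p ≡ ±2 (mod 5)`, `p ≥ 7`.** [folklore] -/
theorem exists_threePlus_classNumber_lt {p : ℕ} (hp : p.Prime) (hp4 : p % 4 = 3) (hp5 : p % 5 = 2 ∨ p % 5 = 3)
    (h7 : 7 ≤ p) :
    ∃ q : ℕ, q.Prime ∧ q % 8 = 3 ∧ jacobiSym (q : ℤ) p = 1 ∧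
      ∀ (K : Type) [Field K] [NumberField K], IsImaginaryQuadratic K →
        NumberField.discr K = -((5 * q : ℕ) : ℤ) → NumberField.classNumber K < p := by
  rcases Nat.lt_or_ge p 800 with h800 | h800
  · obtain ⟨q, hq, hq8, hJ, hh⟩ := exists_partner_threePlus_of_lt hp hp4 hp5 h7 h800
    exact ⟨q, hq, hq8, hJ, classNumber_lt_of_binQF hq hh⟩
  · obtain ⟨q, hq, hq8, hJ, hle⟩ := indefinitePinThreePlus hp hp4 h800
    refine ⟨q, hq, hq8, hJ, classNumber_lt_of_size hq (inv_pi_mul_sqrt_mul_log_lt_fifty ?_ ?_ h800)⟩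
    · have := hq.two_le
      positivity
    · have hqp : q ≠ p := ne_of_jacobiSym_ne_zero hp (by rw [hJ]; norm_num)
      have hlt : 5 * q < 50 * p := by omega
      exact_mod_cast hlt

/-- **Type `(3,−)` with `h(ℚ(√−5q)) < p`, every prime `p ≡ 3 (mod 8)`, `p ≡ ±1 (mod 5)`.** [folklore] -/
theorem exists_threeMinus_classNumber_lt {p : ℕ} (hp : p.Prime) (hp8 : p % 8 = 3) (hp5 : p % 5 = 1 ∨ p % 5 = 4) :
    ∃ q : ℕ, q.Prime ∧ q % 8 = 3 ∧ jacobiSym (q : ℤ) p = -1 ∧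
      ∀ (K : Type) [Field K] [NumberField K], IsImaginaryQuadratic K →
        NumberField.discr K = -((5 * q : ℕ) : ℤ) → NumberField.classNumber K < p := by
  rcases Nat.lt_or_ge p 200 with h200 | h200
  · obtain ⟨q, hq, hq8, hJ, hh⟩ := exists_partner_threeMinus_of_lt hp hp8 hp5 h200
    exact ⟨q, hq, hq8, hJ, classNumber_lt_of_binQF hq hh⟩
  · obtain ⟨q, hq, hq8, hJ, hle⟩ := indefinitePinThreeMinus_of_mod_eight_eq_three hp hp8 h200
    refine ⟨q, hq, hq8, hJ, classNumber_lt_of_size hq (inv_pi_mul_sqrt_mul_log_lt_twenty ?_ ?_ h200)⟩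
    · have := hq.two_le
      positivity
    · have hqp : q ≠ p := ne_of_jacobiSym_ne_zero hp (by rw [hJ]; norm_num)
      have hlt : 5 * q < 20 * p := by omega
      exact_mod_cast hlt

end Summit.BirchSwinnertonDyer.BirchSwinnertonDyer.Theorems.BiquadraticEisensteinDescentHeegnerTwistCouplingInSupplyIndefinitePinWitness
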